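import Summits.QuantumFields.YangMills.Theorems.IR.AfPincerUcTypChain
import HarnessLib

/-!
# Crux `IR` (stmt-QuantumFields-19354), line `af-pincer-Uc`: the SHARP insertion-tolerance guard for the class of record `TypChain`
# (helper module, `--supports stmt-QuantumFields-19354 --as helper`; it closes nothing; filed by ym-cruxidea-19354-nsc g3 under OWNER R118a (2))

Owner R107∕R109∕R112 made `SharpLanes.InsertionTolerant ρ w θ R ℓ₁ Typ` (`AfPincerUcSharpLanesTolerance`) the supplier obligation of
record for the format's `∃ Typ`, with class of record `SharpLanes.TypChain ρ θ w ℓ₀` (`AfPincerUcTypChain`, p537603), whose tolerance the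
tree proves with the crude guard `60·ℓ₁ ≤ ℓ₀` (`insertionTolerant_typChain`).  THIS FILE proves it down to the SHARP guard, over the same
objects and with no new definitions:

* `insertionTolerant_typChain_sharp : θg < θb → 3 ≤ R → 3·ℓ₁ ≤ ℓ₀ + 1 → InsertionTolerant ρ w θg R ℓ₁ (TypChain ρ θb w ℓ₀)`,
  i.e. `ℓ₀ ≥ 3ℓ₁ − 1` suffices.  SHARPNESS (on paper, not formalised here): `ℓ₁` re-set links `(x + 3t·e₁, 0)`, `t < ℓ₁`, dotted at
  spacing `3` inside one cell of the trivial configuration, with a value `h`, `Re tr ρ h ≤ N − θb`, make the `(0,1)`-plaquettes based at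
  `x + (3t−1)e₁` and `x + 3t·e₁` all `θb`-bad — ONE step-2 chain of extent exactly `3ℓ₁ − 2`; so `TypChain ρ θb w ℓ₀` is NOT `ℓ₁`-insertion
  tolerant for `ℓ₀ ≤ 3ℓ₁ − 2` (any `R`, any `θg ≥ 0`), and `3ℓ₁ − 1` is the exact threshold.  The two points the crude count misses: a hop
  between CONSECUTIVE chain plaquettes moves the touched `P`-link base by `≤ 3` PER COORDINATE WITH SIGNS (`edge base − plaquette base ∈
  {0, e_a, e_b}`, so `[0,1] + [−2,2] + [−1,0] = [−3,3]`; `fst_sub_of_mem_plaquetteEdges`), and LOOP ERASURE over the `≤ ℓ₁` distinct touched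
  links (`dist_add_le_mul_card`) replaces the injective-subchain count.
* `insertionTolerant_typChain_record`: the constants of record `(ℓ₁, ℓ₀, R) = (6, 17, 3)`, every `θg < θb` (owner R109 (4)∕R118a (2): `≥ 6`
  inserted links tolerated; they instantiate the S-142 guard `1 ≤ ℓ₀ ∧ 3 ≤ R ∧ 0 < θ` non-vacuously once `0 < θg` is fixed by the caller);
  the format's `8ℓ₀ = 136 ≤ b` is harmless as `b → ∞`.  (The crude guard would ask `ℓ₀ ≥ 360`, `b ≥ 2880`.)

HONEST FRAMING: a sharpened constant in ONE kernel-checked supplier property of ONE cell-local family for ONE open residual stub of a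
CONDITIONAL chain; nothing here proves weak-coupling mixing, (WKR), any clause of the format, or a mass gap; not Clay.  No `sorry`;
axioms ⊆ {propext, Classical.choice, Quot.sound}.
-/

set_option autoImplicit false

open Literature.MathematicalPhysics.QuantumFieldTheory hiding ZdEdge
open Literature.MathematicalPhysics.QuantumLattice
open Literature.Probability.LatticeModels (Site)
open Summit.QuantumFields.YangMills.Cruxes.IR.Tempered (cellEdges)
open Summit.QuantumFields.YangMills.Theorems.OddTorusChessboard (cellPlaqs plaqAction)

namespace Summit.QuantumFields.YangMills.Cruxes.IR.AfPincerUc.SharpLanes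

/-! ## §1 The combinatorial heart: hop sequences through few points are short (loop erasure as an inequality) -/

/-- **Loop erasure as an inequality.**  If `c 0, c 1, …, c k` has hops `d (c n) (c (n+1)) ≤ D` for a pseudo-distance `d` (zero on
the diagonal, triangle inequality, `D ≥ 0`), then `d (c 0) (c k) ≤ D · (#{c 0, …, c k} − 1)`. -/
theorem dist_add_le_mul_card {X : Type*} [DecidableEq X] (d : X → X → ℤ) (hd0 : ∀ x, d x x = 0)
    (htri : ∀ x y z, d x z ≤ d x y + d y z) {D : ℤ} (hD : 0 ≤ D) (c : ℕ → X) :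
    ∀ k : ℕ, (∀ n < k, d (c n) (c (n + 1)) ≤ D) →
      d (c 0) (c k) + D ≤ D * (((Finset.range (k + 1)).image c).card : ℤ) := by
  intro k
  induction k using Nat.strong_induction_on with
  | _ k ih =>
    intro hstep
    rcases k with _ | k
    · simp [hd0]
    · by_cases hmem : c (k + 1) ∈ (Finset.range (k + 1)).image c
      · obtain ⟨j, hj, hjc⟩ := Finset.mem_image.1 hmem
        have hjk : j < k + 1 := Finset.mem_range.1 hj
        have ihj := ih j hjk (fun n hn => hstep n (by omega))
        have hsub : Finset.range (j + 1) ⊆ Finset.range (k + 1 + 1) := by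
          intro x hx
          simp only [Finset.mem_range] at hx ⊢
          omega
        have hmono : ((((Finset.range (j + 1)).image c).card : ℕ) : ℤ) ≤
            ((((Finset.range (k + 1 + 1)).image c).card : ℕ) : ℤ) := by
          exact_mod_cast Finset.card_le_card (Finset.image_subset_image hsub)
        rw [← hjc]
        exact ihj.trans (mul_le_mul_of_nonneg_left hmono hD)
      · have ihk := ih k (Nat.lt_succ_self k) (fun n hn => hstep n (by omega))
        have hcard : ((Finset.range (k + 1 + 1)).image c).card = ((Finset.range (k + 1)).image c).card + 1 := by
          rw [Finset.range_add_one, Finset.image_insert, Finset.card_insert_of_notMem hmem]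
        have hs := hstep k (by omega)
        have ht := htri (c 0) (c k) (c (k + 1))
        rw [hcard, Nat.cast_add, Nat.cast_one, mul_add, mul_one]
        linarith

/-! ## §2 The signed offset of an edge base inside its plaquette -/

/-- An edge of the plaquette `p` has base point `p.1 + δ` with `δ ∈ {0, e_a, e_b}`: coordinatewise offset in `[0, 1]` (the SIGNED
form of `SharpLanes.abs_sub_le_one_of_mem_plaquetteEdges`; the sign is what brings the per-hop constant from `4` to `3`). -/
theorem fst_sub_of_mem_plaquetteEdges {p : ZdPlaquette 4} {e : ZdEdge 4} (he : e ∈ plaquetteEdges p) (j : Fin 4) :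
    0 ≤ e.1 j - p.1 j ∧ e.1 j - p.1 j ≤ 1 := by
  simp only [plaquetteEdges, Finset.mem_insert, Finset.mem_singleton] at he
  rcases he with rfl | rfl | rfl | rfl
  · simp
  · simp only [Pi.add_apply, add_sub_cancel_left, Pi.single_apply]
    split <;> simp
  · simp only [Pi.add_apply, add_sub_cancel_left, Pi.single_apply]
    split <;> simp
  · simp

/-! ## §3 R109 (3) with the sharp guard `ℓ₀ ≥ 3ℓ₁ − 1` -/

variable {G : Type} [Group G] {N : ℕ} {ρ : G →* Matrix (Fin N) (Fin N) ℂ}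

/-- **R109 (3), SHARP GUARD (PROVED).**  For `θg < θb`, `R ≥ 3` and `3ℓ₁ ≤ ℓ₀ + 1`, the short-chain class `TypChain ρ θb w ℓ₀` is
`(θg, R, ℓ₁)`-insertion tolerant.  Proof: plaquettes off `P` keep their action, so a chain plaquette off `P` is `θb`-bad in `U`, hence
not `θg`-clean, hence outside the guard — but a chain neighbour touching `P` puts it inside the guard (`mem_guard_of_near_touching`):
so the chain is ALL-OFF `P` (then it is a chain of `U ∈ TypChain`: impossible) or ALL-ON `P`; in the latter case pick for each chain
plaquette a touched link of `P`; consecutive picks differ by `≤ 3` per coordinate with signs (§2), loop erasure (§1) over the `≤ ℓ₁`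
distinct picks bounds the end-to-end link displacement by `3(ℓ₁ − 1)`, and the two end offsets add `≤ 1`: extent `≤ 3ℓ₁ − 2 < ℓ₀`. -/
theorem insertionTolerant_typChain_sharp {θg θb : ℝ} (hθ : θg < θb) (w : Fin 4 → ℤ → ℤ) {R ℓ₀ ℓ₁ : ℕ} (hR : 3 ≤ R)
    (hℓ : 3 * ℓ₁ ≤ ℓ₀ + 1) : InsertionTolerant ρ w θg R ℓ₁ (TypChain ρ θb w ℓ₀) := by
  classical
  intro c U hU P _hPc hPm hclean V hVU
  rintro ⟨k, q, hqin, hqbad, hqstep, hqext⟩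
  have hin' : ∀ i, q i ∈ cellPlaqs w c := fun i => Finset.mem_coe.1 (hqin i)
  -- (1) a chain plaquette off `P` is `θb`-bad in `U`
  have hbadU : ∀ i, ¬ (plaquetteEdges (q i) ∩ P).Nonempty → θb ≤ plaqAction ρ (q i) U := by
    intro i hi
    have h := hqbad i
    rwa [plaqAction_eq_of_not_touching ρ hVU hi] at h
  -- (2) no mixed pair at chain distance
  have hmix : ∀ i j : Fin (k + 1), supNormZ4 ((q i).1 - (q j).1) ≤ 2 →
      (plaquetteEdges (q i) ∩ P).Nonempty → (plaquetteEdges (q j) ∩ P).Nonempty := by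
    intro i j hij hi
    by_contra hj
    have hmem := mem_guard_of_near_touching (R := R) hR hi (hin' j) hij
    have h1 := hclean _ hmem
    have h2 := hbadU j hj
    linarith
  -- (3) all-or-none along the chain
  have hprop : ∀ n (hn : n < k + 1),
      ((plaquetteEdges (q 0) ∩ P).Nonempty ↔ (plaquetteEdges (q ⟨n, hn⟩) ∩ P).Nonempty) := by
    intro n
    induction n with
    | zero => intro hn; exact Iff.rfl
    | succ n ih =>
      intro hn
      rw [ih (by omega)]
      have hs := hqstep ⟨n, by omega⟩
      exact ⟨hmix ⟨n, by omega⟩ ⟨n + 1, hn⟩ hs,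
        hmix ⟨n + 1, hn⟩ ⟨n, by omega⟩ (by rw [supNormZ4_sub_comm]; exact hs)⟩
  by_cases h0 : (plaquetteEdges (q 0) ∩ P).Nonempty
  · -- ALL ON `P`: loop erasure over the touched links
    have hall : ∀ i, (plaquetteEdges (q i) ∩ P).Nonempty := fun i => (hprop i.1 i.2).1 h0
    have hf : ∀ i : Fin (k + 1), ∃ e, e ∈ plaquetteEdges (q i) ∧ e ∈ P := fun i => by
      obtain ⟨e, he⟩ := hall i
      exact ⟨e, (Finset.mem_inter.1 he).1, (Finset.mem_inter.1 he).2⟩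
    choose f hfq hfP using hf
    let g : ℕ → ZdEdge 4 := fun n => if h : n < k + 1 then f ⟨n, h⟩ else f 0
    have hg : ∀ n (h : n < k + 1), g n = f ⟨n, h⟩ := fun n h => dif_pos h
    have himg : ((Finset.range (k + 1)).image g).card ≤ ℓ₁ := by
      refine le_trans (Finset.card_le_card ?_) hPm
      intro e he
      obtain ⟨n, hn, rfl⟩ := Finset.mem_image.1 he
      rw [hg n (Finset.mem_range.1 hn)]
      exact hfP _
    have hcoord : ∀ j : Fin 4, (((q 0).1 - (q (Fin.last k)).1) j).natAbs + 2 ≤ 3 * ℓ₁ := by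
      intro j
      have key := dist_add_le_mul_card (fun e e' : ZdEdge 4 => |e.1 j - e'.1 j|) (fun x => by simp)
        (fun x y z => abs_sub_le _ _ _) (by norm_num : (0 : ℤ) ≤ 3) g k (fun n hn => by
          rw [hg n (by omega), hg (n + 1) (by omega)]
          have hs := (supNormZ4_sub_le_iff_abs.1 (hqstep ⟨n, hn⟩)) j
          have ho1 := fst_sub_of_mem_plaquetteEdges (hfq ⟨n, by omega⟩) j
          have ho2 := fst_sub_of_mem_plaquetteEdges (hfq ⟨n + 1, by omega⟩) j
          simp only [Fin.castSucc_mk, Fin.succ_mk] at hs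
          rw [abs_le] at hs ⊢
          constructor <;> omega)
      rw [hg 0 (by omega), hg k (by omega)] at key
      have ho1 := fst_sub_of_mem_plaquetteEdges (hfq 0) j
      have ho2 := fst_sub_of_mem_plaquetteEdges (hfq (Fin.last k)) j
      have hmz : ((((Finset.range (k + 1)).image g).card : ℕ) : ℤ) ≤ (ℓ₁ : ℤ) := by exact_mod_cast himg
      have hkey : |(f 0).1 j - (f (Fin.last k)).1 j| ≤ 3 * (ℓ₁ : ℤ) - 3 := by
        have hk' : (⟨k, by omega⟩ : Fin (k + 1)) = Fin.last k := rfl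
        have h0' : (⟨0, by omega⟩ : Fin (k + 1)) = 0 := rfl
        rw [hk', h0'] at key
        linarith
      have habs : (((((q 0).1 - (q (Fin.last k)).1) j).natAbs : ℕ) : ℤ) + 2 ≤ 3 * (ℓ₁ : ℤ) := by
        rw [Int.natCast_natAbs, Pi.sub_apply]
        suffices h : |(q 0).1 j - (q (Fin.last k)).1 j| ≤ 3 * (ℓ₁ : ℤ) - 2 by linarith
        rw [abs_le] at hkey ⊢
        constructor <;> linarith [hkey.1, hkey.2, ho1.1, ho1.2, ho2.1, ho2.2]
      exact_mod_cast habs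
    have hsup : supNormZ4 ((q 0).1 - (q (Fin.last k)).1) ≤ 3 * ℓ₁ - 2 :=
      supNormZ4_le_iff.2 fun j => by have := hcoord j; omega
    have h2 : 2 ≤ 3 * ℓ₁ := by have := hcoord 0; omega
    omega
  · -- ALL OFF `P`: the chain was already a chain of `U ∈ TypChain`
    have hnone : ∀ i, ¬ (plaquetteEdges (q i) ∩ P).Nonempty := fun i hi => h0 ((hprop i.1 i.2).2 hi)
    exact hU ⟨k, q, hqin, fun i => hbadU i (hnone i), hqstep, hqext⟩

/-- **Constants of record for the card's supplier (R109 (4)).**  With `ℓ₁ = 6` tolerated insertions, `TypChain ρ θb w ℓ₀` for any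
`ℓ₀ ≥ 17` is `(θg, 3, 6)`-insertion tolerant for every `θg < θb` (and, by `InsertionTolerant.mono`, at every radius `R ≥ 3` and every
smaller guard threshold). -/
theorem insertionTolerant_typChain_record {θg θb : ℝ} (hθ : θg < θb) (w : Fin 4 → ℤ → ℤ) {ℓ₀ : ℕ} (hℓ : 17 ≤ ℓ₀) :
    InsertionTolerant ρ w θg 3 6 (TypChain ρ θb w ℓ₀) :=
  insertionTolerant_typChain_sharp hθ w le_rfl (by omega)

end Summit.QuantumFields.YangMills.Cruxes.IR.AfPincerUc.SharpLanes
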